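import Mathlib
import HarnessLib
import Literature.Analysis.Calculus.IteratedDifferenceMixedBound
import Literature.MathematicalPhysics.QuantumLattice.FramePosKernelFirstMoment
import Literature.MathematicalPhysics.QuantumLattice.HubbardUVSymbolBandIncrements

/-!
# Fibrewise envelopes of the ultraviolet symbol and its frequency translates, and the SAMPLING of mixed lattice differences of
# `g(ω, u(p⃗))·κ(p⃗)` on the dual torus `(ℤ/L)²`

Topic `MathematicalPhysics/QuantumLattice`; continues `HubbardUVSymbolBandIncrements`.  For the first space moments of the scale-`0`
covariance of a framed band, telescoped over the pieces of the frame (Benfatto–Giuliani–Mastropietro 2006, §2.1 (2.36aa) and §3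
(3.2)–(3.8)), every term is a mixed lattice difference `Δ_{e_l}^a Δ_{e_{l'}}^b` (unit steps on `(ℤ/L)²`, i.e. steps `2π/L` in momentum)
of a lattice function of the form `y ↦ g(ω, ũ(p_y))·κ̃(p_y)` — `g` one of `Ψ`, `∂_eΨ`, `Ψ(·+δ e₀) − Ψ`, `∂_e(Ψ(·+δ e₀) − Ψ)`
(`δ = 2π/β` one Matsubara step), `ũ` an interpolated band and `κ̃` a frame piece, both smooth and `2π`-periodic on the momentum plane.
This file turns such differences into numbers:

* `FibreEnvBound Λ g k C σ` — `‖Dⁱg(x)‖ ≤ C·2/max(|x₀| − σ, Λ/2)` for `i ≤ k` (ONE power of the — possibly shifted — frequency envelope,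
  the rest of the decay absorbed into `C` via `(2/max)^{i} ≤ (4/Λ)^i`, `Λ ≤ 4`); instances **`fibreEnvBound_uvSymbol₂`**,
  **`fibreEnvBound_fbDir_uvSymbol₂`**, **`fibreEnvBound_fbShiftSub_uvSymbol₂`**, **`fibreEnvBound_fbDir_fbShiftSub_uvSymbol₂`**
  (`fbShiftSub g δ = g(· + δ e₀) − g`, `norm_iteratedFDeriv_sub_shift_le_of_envelope`: the segment from `x` to `x + δe₀` stays above the
  shifted envelope);
* `PlanePeriodic`, `fwdDiff_iter₂_sample_eq` (two directions; from `FramePosKernelFirstMoment.fwdDiff_iter_sample_eq`),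
  `fwdDiff_iter_comp_toLp`, **`norm_fwdDiff_iter₂_sample_le`** — `‖Δ_{e_l}^aΔ_{e_{l'}}^b(Φ∘p)(y)‖ ≤ K·(2π/L)^{a+b}` when `‖D^{a+b}Φ‖ ≤ K`
  on the Euclidean momentum plane (`IteratedDifferenceMixedBound.norm_fwdDiff_iter_fwdDiff_iter_le`);
* **`norm_fwdDiff_iter₂_comp_sample_le`**, **`norm_fwdDiff_iter₂_comp_mul_sample_le`**, **`norm_fwdDiff_iter₂_increment_sample_le`** —
  the sampled forms of the Faà di Bruno, Leibniz and band-increment bounds: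
  `(2π/L)^k·C·E_σ(ω)·k!·Dᵏ`, `(2π/L)^k·C·E_σ(ω)·Σ_j C(k,j)·j!·Dʲ·W_{k-j}`.

Everything is proved; `FibreEnvBound`, `fbShiftSub`, `PlanePeriodic` are the only definitions; no named facts.

## Sources

G. Benfatto, A. Giuliani, V. Mastropietro, Ann. Henri Poincaré 7 (2006) 809–898, §2.1 (2.36aa), Lemma 2.2, §3 (3.2)–(3.8)
(`BenfattoGiulianiMastropietro2006`); M. Salmhofer, *Renormalization* (1999), §4.2.4 (4.63), §4.2.5 (4.70) (`Salmhofer1999`).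
-/

noncomputable section

namespace Literature.MathematicalPhysics.QuantumLattice

open Literature.Probability.LatticeModels Literature.Analysis.Calculus Set Complex Filter
open scoped Nat Topology

/-! ### §1 Fibrewise envelope bounds -/

/-- **Fibrewise envelope bound** of order `≤ k`, constant `C`, frequency shift `σ`: `‖Dⁱg(x)‖ ≤ C·2/max(|x₀| − σ, Λ/2)` for all `i ≤ k`
and all points `x` of the frequency–band plane. [cite: BenfattoGiulianiMastropietro2006, §2.1 Lemma 2.2] -/
def FibreEnvBound (Λ : ℝ) (g : FreqBand → ℂ) (k : ℕ) (C σ : ℝ) : Prop :=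
  ∀ i ≤ k, ∀ x : FreqBand, ‖iteratedFDeriv ℝ i g x‖ ≤ C * (2 / max (|x 0| - σ) (Λ / 2))

/-- The constant of a fibrewise envelope bound is non-negative. [cite: BenfattoGiulianiMastropietro2006, §2.1 Lemma 2.2] -/
theorem FibreEnvBound.nonneg {Λ : ℝ} (hΛ : 0 < Λ) {g : FreqBand → ℂ} {k : ℕ} {C σ : ℝ} (h : FibreEnvBound Λ g k C σ) : 0 ≤ C := by
  have h0 := h 0 (Nat.zero_le _) 0
  have hE : 0 < 2 / max (|(0 : FreqBand) 0| - σ) (Λ / 2) := div_pos two_pos (lt_max_of_lt_right (by positivity))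
  nlinarith [norm_nonneg (iteratedFDeriv ℝ 0 g 0)]

/-- Lowering the order of a fibrewise envelope bound. [cite: BenfattoGiulianiMastropietro2006, §2.1 Lemma 2.2] -/
theorem FibreEnvBound.of_le {Λ : ℝ} {g : FreqBand → ℂ} {k k' : ℕ} {C σ : ℝ} (h : FibreEnvBound Λ g k C σ) (hk : k' ≤ k) :
    FibreEnvBound Λ g k' C σ := fun i hi x => h i (hi.trans hk) x

/-- **`Ψ` itself**: `‖DⁱΨ(x)‖ ≤ cB(k+1)!(4/Λ)ᵏ·2/max(|x₀|,Λ/2)` for `i ≤ k ≤ N` (`Λ ≤ 4`). [cite: Salmhofer1999, §4.2.5 (4.70)] -/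
theorem fibreEnvBound_uvSymbol₂ {c Λ : ℝ} (hc : 0 ≤ c) (hΛ : 0 < Λ) (hΛ4 : Λ ≤ 4) {N : ℕ} {B : ℝ} (hB1 : 1 ≤ B)
    (hB : ∀ i ≤ N, ∀ t, ‖iteratedDeriv i salmhoferCutoff t‖ ≤ B) {k : ℕ} (hk : k ≤ N) :
    FibreEnvBound Λ (uvSymbol₂ c Λ) k (c * B * (k + 1) ! * (4 / Λ) ^ k) 0 := by
  intro i hi x
  have h := norm_iteratedFDeriv_uvSymbol₂_le hc hΛ hB1 hB (hi.trans hk) x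
  have hB0 : 0 ≤ B := zero_le_one.trans hB1
  have h4 : (1 : ℝ) ≤ 4 / Λ := by rw [le_div_iff₀ hΛ]; linarith
  have hpow := two_div_max_pow_add_le hΛ (|x 0|) i 1
  rw [pow_one] at hpow
  rw [sub_zero]
  have hE : 0 ≤ 2 / max |x 0| (Λ / 2) := div_nonneg zero_le_two (le_max_of_le_right (by positivity))
  calc ‖iteratedFDeriv ℝ i (uvSymbol₂ c Λ) x‖ ≤ c * B * (i + 1) ! * (2 / max |x 0| (Λ / 2)) ^ (i + 1) := h
    _ ≤ c * B * (k + 1) ! * ((4 / Λ) ^ k * (2 / max |x 0| (Λ / 2))) := by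
        have hf : ((i + 1) ! : ℝ) ≤ (k + 1) ! := by exact_mod_cast Nat.factorial_le (by omega)
        have hp : (4 / Λ) ^ i * (2 / max |x 0| (Λ / 2)) ≤ (4 / Λ) ^ k * (2 / max |x 0| (Λ / 2)) :=
          mul_le_mul_of_nonneg_right (pow_le_pow_right₀ h4 hi) hE
        have hcB : 0 ≤ c * B := mul_nonneg hc hB0
        calc c * B * (i + 1) ! * (2 / max |x 0| (Λ / 2)) ^ (i + 1) ≤ c * B * (i + 1) ! * ((4 / Λ) ^ i * (2 / max |x 0| (Λ / 2))) :=
              mul_le_mul_of_nonneg_left hpow (by positivity)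
          _ ≤ c * B * (k + 1) ! * ((4 / Λ) ^ k * (2 / max |x 0| (Λ / 2))) := by
              apply mul_le_mul (mul_le_mul_of_nonneg_left hf hcB) hp (by positivity) (by positivity)
    _ = c * B * (k + 1) ! * (4 / Λ) ^ k * (2 / max (|x 0|) (Λ / 2)) := by ring

/-- **`∂_vΨ`**: `‖Dⁱ∂_vΨ(x)‖ ≤ ‖v‖·cB(k+2)!(4/Λ)^{k+1}·2/max(|x₀|,Λ/2)` for `i ≤ k`, `k + 1 ≤ N` (`Λ ≤ 4`). [cite: Salmhofer1999, §4.2.5 (4.70)] -/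
theorem fibreEnvBound_fbDir_uvSymbol₂ {c Λ : ℝ} (hc : 0 ≤ c) (hΛ : 0 < Λ) (hΛ4 : Λ ≤ 4) {N : ℕ} {B : ℝ} (hB1 : 1 ≤ B)
    (hB : ∀ i ≤ N, ∀ t, ‖iteratedDeriv i salmhoferCutoff t‖ ≤ B) {k : ℕ} (hk : k + 1 ≤ N) (v : FreqBand) :
    FibreEnvBound Λ (fbDir (uvSymbol₂ c Λ) v) k (‖v‖ * (c * B * (k + 2) ! * (4 / Λ) ^ (k + 1))) 0 := by
  intro i hi x
  have h := norm_iteratedFDeriv_fbDir_uvSymbol₂_le hc hΛ hB1 hB (i := i) (by omega) v x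
  have hB0 : 0 ≤ B := zero_le_one.trans hB1
  have h4 : (1 : ℝ) ≤ 4 / Λ := by rw [le_div_iff₀ hΛ]; linarith
  have hpow := two_div_max_pow_add_le hΛ (|x 0|) (i + 1) 1
  rw [pow_one] at hpow
  rw [sub_zero]
  have hE : 0 ≤ 2 / max |x 0| (Λ / 2) := div_nonneg zero_le_two (le_max_of_le_right (by positivity))
  have hf : ((i + 2) ! : ℝ) ≤ (k + 2) ! := by exact_mod_cast Nat.factorial_le (by omega)
  have hp : (4 / Λ) ^ (i + 1) * (2 / max |x 0| (Λ / 2)) ≤ (4 / Λ) ^ (k + 1) * (2 / max |x 0| (Λ / 2)) :=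
    mul_le_mul_of_nonneg_right (pow_le_pow_right₀ h4 (by omega)) hE
  calc ‖iteratedFDeriv ℝ i (fbDir (uvSymbol₂ c Λ) v) x‖ ≤ ‖v‖ * (c * B * (i + 2) ! * (2 / max |x 0| (Λ / 2)) ^ (i + 2)) := h
    _ ≤ ‖v‖ * (c * B * (k + 2) ! * ((4 / Λ) ^ (k + 1) * (2 / max |x 0| (Λ / 2)))) := by
        refine mul_le_mul_of_nonneg_left ?_ (norm_nonneg _)
        calc c * B * (i + 2) ! * (2 / max |x 0| (Λ / 2)) ^ (i + 2)
            ≤ c * B * (i + 2) ! * ((4 / Λ) ^ (i + 1) * (2 / max |x 0| (Λ / 2))) := by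
              rw [show i + 2 = i + 1 + 1 by ring]; exact mul_le_mul_of_nonneg_left hpow (by positivity)
          _ ≤ c * B * (k + 2) ! * ((4 / Λ) ^ (k + 1) * (2 / max |x 0| (Λ / 2))) :=
              mul_le_mul (mul_le_mul_of_nonneg_left hf (mul_nonneg hc hB0)) hp (by positivity) (by positivity)
    _ = ‖v‖ * (c * B * (k + 2) ! * (4 / Λ) ^ (k + 1)) * (2 / max (|x 0|) (Λ / 2)) := by ring

/-! ### §2 Frequency translates: `g(· + δe₀) − g` -/

/-- The frequency-translate difference `g(x + δ e₀) − g(x)`. [cite: BenfattoGiulianiMastropietro2006, (2.36aa)] -/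
def fbShiftSub (g : FreqBand → ℂ) (δ : ℝ) (x : FreqBand) : ℂ := g (x + δ • fbE0) - g x

/-- On the band line: `(g(·+δe₀) − g)(ω, e) = g(ω + δ, e) − g(ω, e)`. [cite: BenfattoGiulianiMastropietro2006, (2.36aa)] -/
theorem fbShiftSub_fbPt (g : FreqBand → ℂ) (δ ω e : ℝ) : fbShiftSub g δ (fbPt ω e) = g (fbPt (ω + δ) e) - g (fbPt ω e) := by
  have h : fbPt ω e + δ • fbE0 = fbPt (ω + δ) e := by simp only [fbPt, add_smul]; abel
  rw [fbShiftSub, h]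

/-- `g(·+δe₀) − g` is as smooth as `g`. [cite: BenfattoGiulianiMastropietro2006, (2.36aa)] -/
theorem contDiff_fbShiftSub {g : FreqBand → ℂ} {n : WithTop ℕ∞} (hg : ContDiff ℝ n g) (δ : ℝ) : ContDiff ℝ n (fbShiftSub g δ) :=
  (hg.comp (contDiff_id.add contDiff_const)).sub hg

/-- `Dⁱ(g(·+δe₀) − g)(x) = Dⁱg(x + δe₀) − Dⁱg(x)`. [cite: BenfattoGiulianiMastropietro2006, (2.36aa)] -/
theorem iteratedFDeriv_fbShiftSub {g : FreqBand → ℂ} {i : ℕ} (hg : ContDiff ℝ i g) (δ : ℝ) (x : FreqBand) :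
    iteratedFDeriv ℝ i (fbShiftSub g δ) x = iteratedFDeriv ℝ i g (x + δ • fbE0) - iteratedFDeriv ℝ i g x := by
  have h1 : ContDiff ℝ i (fun x => g (x + δ • fbE0)) := hg.comp (contDiff_id.add contDiff_const)
  have h : fbShiftSub g δ = (fun x => g (x + δ • fbE0)) - g := rfl
  rw [h, iteratedFDeriv_sub_apply h1.contDiffAt hg.contDiffAt, iteratedFDeriv_comp_add_right]

/-- `∂_v(g(·+δe₀) − g) = (∂_v g)(·+δe₀) − ∂_v g`. [cite: BenfattoGiulianiMastropietro2006, (2.36aa)] -/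
theorem fbDir_fbShiftSub {g : FreqBand → ℂ} (hg : Differentiable ℝ g) (δ : ℝ) (v : FreqBand) :
    fbDir (fbShiftSub g δ) v = fbShiftSub (fbDir g v) δ := by
  funext x
  have h1 : DifferentiableAt ℝ (fun x => g (x + δ • fbE0)) x := (hg _).comp x (differentiableAt_id.add (differentiableAt_const _))
  have h : fbShiftSub g δ = (fun x => g (x + δ • fbE0)) - g := rfl
  show fderiv ℝ (fbShiftSub g δ) x v = fderiv ℝ g (x + δ • fbE0) v - fderiv ℝ g x v
  rw [h, fderiv_sub h1 (hg x), fderiv_comp_add_right]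
  rfl

/-- **The segment from `x` to `x + δe₀` stays above the shifted envelope**: if `‖D^{i+1}g(y)‖ ≤ P·(2/max(|y₀|,Λ/2))ᵖ` everywhere, then
`‖Dⁱg(x + δe₀) − Dⁱg(x)‖ ≤ |δ|·P·(2/max(|x₀| − |δ|, Λ/2))ᵖ`. [cite: BenfattoGiulianiMastropietro2006, §2.1 Lemma 2.2] -/
theorem norm_iteratedFDeriv_sub_shift_le_of_envelope {Λ : ℝ} (hΛ : 0 < Λ) {g : FreqBand → ℂ} {i : ℕ}
    (hg : ContDiff ℝ (↑(i + 1 : ℕ)) g) {P : ℝ} (hP : 0 ≤ P) {p : ℕ}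
    (hb : ∀ y : FreqBand, ‖iteratedFDeriv ℝ (i + 1) g y‖ ≤ P * (2 / max |y 0| (Λ / 2)) ^ p) (δ : ℝ) (x : FreqBand) :
    ‖iteratedFDeriv ℝ i g (x + δ • fbE0) - iteratedFDeriv ℝ i g x‖ ≤ |δ| * (P * (2 / max (|x 0| - |δ|) (Λ / 2)) ^ p) := by
  set m₀ : ℝ := max (|x 0| - |δ|) (Λ / 2) with hm₀
  have hm₀pos : 0 < m₀ := lt_max_of_lt_right (by positivity)
  set K : ℝ := P * (2 / m₀) ^ p with hK
  have hdiff : Differentiable ℝ (iteratedFDeriv ℝ i g) := hg.differentiable_iteratedFDeriv (by exact_mod_cast Nat.lt_succ_self i)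
  have hseg : ∀ y ∈ segment ℝ x (x + δ • fbE0), ‖fderiv ℝ (iteratedFDeriv ℝ i g) y‖ ≤ K := by
    intro y hy
    rw [norm_fderiv_iteratedFDeriv]
    rw [segment_eq_image_lineMap] at hy
    obtain ⟨t, ⟨ht0, ht1⟩, rfl⟩ := hy
    have hy0 : (AffineMap.lineMap x (x + δ • fbE0) t : FreqBand) 0 = x 0 + t * δ := by
      rw [AffineMap.lineMap_apply_module]
      simp [fbE0]
      ring
    have hmin : |x 0| - |δ| ≤ |(AffineMap.lineMap x (x + δ • fbE0) t : FreqBand) 0| := by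
      rw [hy0]
      have h1 : |x 0| - |t * δ| ≤ |x 0 + t * δ| := by
        have := abs_sub_abs_le_abs_sub (x 0) (-(t * δ))
        rw [abs_neg, sub_neg_eq_add] at this
        exact this
      have h2 : |t * δ| ≤ |δ| := by
        rw [abs_mul, abs_of_nonneg ht0]; exact mul_le_of_le_one_left (abs_nonneg _) ht1
      linarith
    have hmy : m₀ ≤ max |(AffineMap.lineMap x (x + δ • fbE0) t : FreqBand) 0| (Λ / 2) := max_le_max hmin le_rfl
    have h := hb (AffineMap.lineMap x (x + δ • fbE0) t)
    refine h.trans ?_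
    have hfrac : 2 / max |(AffineMap.lineMap x (x + δ • fbE0) t : FreqBand) 0| (Λ / 2) ≤ 2 / m₀ :=
      div_le_div_of_nonneg_left (by norm_num) hm₀pos hmy
    have hE : 0 ≤ 2 / max |(AffineMap.lineMap x (x + δ • fbE0) t : FreqBand) 0| (Λ / 2) :=
      div_nonneg zero_le_two (le_max_of_le_right (by positivity))
    exact mul_le_mul_of_nonneg_left (pow_le_pow_left₀ hE hfrac _) hP
  have h := (convex_segment x (x + δ • fbE0)).norm_image_sub_le_of_norm_fderiv_le (fun y _ => hdiff y) hseg
    (left_mem_segment ℝ x (x + δ • fbE0)) (right_mem_segment ℝ x (x + δ • fbE0))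
  have hnorm : ‖x + δ • fbE0 - x‖ = |δ| := by rw [add_sub_cancel_left, norm_smul, norm_fbE0, mul_one, Real.norm_eq_abs]
  rw [hnorm] at h
  calc ‖iteratedFDeriv ℝ i g (x + δ • fbE0) - iteratedFDeriv ℝ i g x‖ ≤ K * |δ| := h
    _ = |δ| * (P * (2 / m₀) ^ p) := by rw [hK]; ring

/-- **`Ψ(·+δe₀) − Ψ`**: `FibreEnvBound Λ (Ψ(·+δe₀) − Ψ) k (|δ|·cB(k+2)!(4/Λ)^{k+1}) |δ|` (`k + 1 ≤ N`, `Λ ≤ 4`).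
[cite: BenfattoGiulianiMastropietro2006, §2.1 Lemma 2.2] -/
theorem fibreEnvBound_fbShiftSub_uvSymbol₂ {c Λ : ℝ} (hc : 0 ≤ c) (hΛ : 0 < Λ) (hΛ4 : Λ ≤ 4) {N : ℕ} {B : ℝ} (hB1 : 1 ≤ B)
    (hB : ∀ i ≤ N, ∀ t, ‖iteratedDeriv i salmhoferCutoff t‖ ≤ B) {k : ℕ} (hk : k + 1 ≤ N) (δ : ℝ) :
    FibreEnvBound Λ (fbShiftSub (uvSymbol₂ c Λ) δ) k (|δ| * (c * B * (k + 2) ! * (4 / Λ) ^ (k + 1))) |δ| := by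
  intro i hi x
  have hB0 : 0 ≤ B := zero_le_one.trans hB1
  rw [iteratedFDeriv_fbShiftSub (contDiff_uvSymbol₂ c hΛ) δ x]
  have hseg := norm_iteratedFDeriv_sub_shift_le_of_envelope hΛ (g := uvSymbol₂ c Λ) (i := i) (contDiff_uvSymbol₂ c hΛ)
    (P := c * B * (i + 2) !) (by positivity) (p := i + 2)
    (fun y => by
      have h := norm_iteratedFDeriv_uvSymbol₂_le hc hΛ hB1 hB (n := i + 1) (by omega) y
      simpa only [show i + 1 + 1 = i + 2 by ring, Nat.cast_add, Nat.cast_one, show (i : ℝ) + 1 + 1 = i + 2 by ring] using h) δ x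
  refine hseg.trans ?_
  have h4 : (1 : ℝ) ≤ 4 / Λ := by rw [le_div_iff₀ hΛ]; linarith
  have hpow := two_div_max_pow_add_le hΛ (|x 0| - |δ|) (i + 1) 1
  rw [pow_one, show i + 1 + 1 = i + 2 by ring] at hpow
  have hE : 0 ≤ 2 / max (|x 0| - |δ|) (Λ / 2) := div_nonneg zero_le_two (le_max_of_le_right (by positivity))
  have hf : ((i + 2) ! : ℝ) ≤ (k + 2) ! := by exact_mod_cast Nat.factorial_le (by omega)
  have hp : (4 / Λ) ^ (i + 1) * (2 / max (|x 0| - |δ|) (Λ / 2)) ≤ (4 / Λ) ^ (k + 1) * (2 / max (|x 0| - |δ|) (Λ / 2)) :=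
    mul_le_mul_of_nonneg_right (pow_le_pow_right₀ h4 (by omega)) hE
  calc |δ| * (c * B * (i + 2) ! * (2 / max (|x 0| - |δ|) (Λ / 2)) ^ (i + 2))
      ≤ |δ| * (c * B * (i + 2) ! * ((4 / Λ) ^ (i + 1) * (2 / max (|x 0| - |δ|) (Λ / 2)))) :=
        mul_le_mul_of_nonneg_left (mul_le_mul_of_nonneg_left hpow (by positivity)) (abs_nonneg _)
    _ ≤ |δ| * (c * B * (k + 2) ! * ((4 / Λ) ^ (k + 1) * (2 / max (|x 0| - |δ|) (Λ / 2)))) :=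
        mul_le_mul_of_nonneg_left (mul_le_mul (mul_le_mul_of_nonneg_left hf (mul_nonneg hc hB0)) hp (by positivity)
          (by positivity)) (abs_nonneg _)
    _ = |δ| * (c * B * (k + 2) ! * (4 / Λ) ^ (k + 1)) * (2 / max (|x 0| - |δ|) (Λ / 2)) := by ring

/-- **`∂_v(Ψ(·+δe₀) − Ψ)`**: `FibreEnvBound Λ (∂_v(Ψ(·+δe₀) − Ψ)) k (|δ|·‖v‖·cB(k+3)!(4/Λ)^{k+2}) |δ|` (`k + 2 ≤ N`, `Λ ≤ 4`).
[cite: BenfattoGiulianiMastropietro2006, §2.1 Lemma 2.2] -/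
theorem fibreEnvBound_fbDir_fbShiftSub_uvSymbol₂ {c Λ : ℝ} (hc : 0 ≤ c) (hΛ : 0 < Λ) (hΛ4 : Λ ≤ 4) {N : ℕ} {B : ℝ} (hB1 : 1 ≤ B)
    (hB : ∀ i ≤ N, ∀ t, ‖iteratedDeriv i salmhoferCutoff t‖ ≤ B) {k : ℕ} (hk : k + 2 ≤ N) (δ : ℝ) (v : FreqBand) :
    FibreEnvBound Λ (fbDir (fbShiftSub (uvSymbol₂ c Λ) δ) v) k (|δ| * ‖v‖ * (c * B * (k + 3) ! * (4 / Λ) ^ (k + 2))) |δ| := by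
  intro i hi x
  have hB0 : 0 ≤ B := zero_le_one.trans hB1
  have hdg : Differentiable ℝ (uvSymbol₂ c Λ) := (contDiff_uvSymbol₂ c hΛ (n := 1)).differentiable one_ne_zero
  have hcd : ContDiff ℝ (↑(i + 1 : ℕ)) (fbDir (uvSymbol₂ c Λ) v) :=
    contDiff_fbDir (contDiff_uvSymbol₂ c hΛ (n := (i + 1 : ℕ) + 1)) v
  rw [fbDir_fbShiftSub hdg, iteratedFDeriv_fbShiftSub (hcd.of_le (by exact_mod_cast Nat.le_succ i)) δ x]
  have hseg := norm_iteratedFDeriv_sub_shift_le_of_envelope hΛ (g := fbDir (uvSymbol₂ c Λ) v) (i := i) hcd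
    (P := ‖v‖ * (c * B * (i + 3) !)) (by positivity) (p := i + 3)
    (fun y => by
      have h := norm_iteratedFDeriv_fbDir_uvSymbol₂_le hc hΛ hB1 hB (i := i + 1) (by omega) v y
      have h' : ‖v‖ * (c * B * (i + 1 + 2) ! * (2 / max |y 0| (Λ / 2)) ^ (i + 1 + 2)) =
          ‖v‖ * (c * B * (i + 3) !) * (2 / max |y 0| (Λ / 2)) ^ (i + 3) := by
        rw [show i + 1 + 2 = i + 3 by ring]; push_cast; ring
      rw [h'] at h; exact h) δ x
  refine hseg.trans ?_
  have h4 : (1 : ℝ) ≤ 4 / Λ := by rw [le_div_iff₀ hΛ]; linarith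
  have hpow := two_div_max_pow_add_le hΛ (|x 0| - |δ|) (i + 2) 1
  rw [pow_one, show i + 2 + 1 = i + 3 by ring] at hpow
  have hE : 0 ≤ 2 / max (|x 0| - |δ|) (Λ / 2) := div_nonneg zero_le_two (le_max_of_le_right (by positivity))
  have hf : ((i + 3) ! : ℝ) ≤ (k + 3) ! := by exact_mod_cast Nat.factorial_le (by omega)
  have hp : (4 / Λ) ^ (i + 2) * (2 / max (|x 0| - |δ|) (Λ / 2)) ≤ (4 / Λ) ^ (k + 2) * (2 / max (|x 0| - |δ|) (Λ / 2)) :=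
    mul_le_mul_of_nonneg_right (pow_le_pow_right₀ h4 (by omega)) hE
  calc |δ| * (‖v‖ * (c * B * (i + 3) !) * (2 / max (|x 0| - |δ|) (Λ / 2)) ^ (i + 3))
      ≤ |δ| * (‖v‖ * (c * B * (i + 3) !) * ((4 / Λ) ^ (i + 2) * (2 / max (|x 0| - |δ|) (Λ / 2)))) :=
        mul_le_mul_of_nonneg_left (mul_le_mul_of_nonneg_left hpow (by positivity)) (abs_nonneg _)
    _ ≤ |δ| * (‖v‖ * (c * B * (k + 3) !) * ((4 / Λ) ^ (k + 2) * (2 / max (|x 0| - |δ|) (Λ / 2)))) :=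
        mul_le_mul_of_nonneg_left (mul_le_mul (mul_le_mul_of_nonneg_left (mul_le_mul_of_nonneg_left hf (mul_nonneg hc hB0))
          (norm_nonneg _)) hp (by positivity) (by positivity)) (abs_nonneg _)
    _ = |δ| * ‖v‖ * (c * B * (k + 3) ! * (4 / Λ) ^ (k + 2)) * (2 / max (|x 0| - |δ|) (Λ / 2)) := by ring

/-! ### §3 Sampling mixed differences on the dual torus `(ℤ/L)²` -/

section Sampling

variable {L : ℕ} [NeZero L] {G : Type*} [AddCommGroup G]

/-- `2π`-periodicity in both momentum coordinates. [cite: BenfattoGiulianiMastropietro2006, §2.1 (2.3)] -/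
def PlanePeriodic (Φ : (Fin 2 → ℝ) → G) : Prop :=
  ∀ (p : Fin 2 → ℝ) (z : Fin 2 → ℤ), Φ (fun i => p i + z i * (2 * Real.pi)) = Φ p

/-- A difference of a periodic function is periodic. [cite: BenfattoGiulianiMastropietro2006, §2.1 (2.3)] -/
theorem PlanePeriodic.fwdDiff {Φ : (Fin 2 → ℝ) → G} (hΦ : PlanePeriodic Φ) (u : Fin 2 → ℝ) : PlanePeriodic (fwdDiff u Φ) := by
  intro p z
  have h : (fun i => p i + z i * (2 * Real.pi)) + u = fun i => (p + u) i + z i * (2 * Real.pi) := by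
    funext i; simp only [Pi.add_apply]; ring
  simp only [_root_.fwdDiff]
  rw [h, hΦ (p + u) z, hΦ p z]

/-- Iterated differences of a periodic function are periodic. [cite: BenfattoGiulianiMastropietro2006, §2.1 (2.3)] -/
theorem PlanePeriodic.fwdDiff_iter {Φ : (Fin 2 → ℝ) → G} (hΦ : PlanePeriodic Φ) (u : Fin 2 → ℝ) :
    ∀ n : ℕ, PlanePeriodic ((_root_.fwdDiff u)^[n] Φ)
  | 0 => hΦ
  | n + 1 => by rw [Function.iterate_succ_apply']; exact (PlanePeriodic.fwdDiff_iter hΦ u n).fwdDiff u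

/-- **Two-direction sampling identity**: unit-step mixed differences of the samples `q ↦ Φ(p_q)` on `(ℤ/L)²` are the samples of the
continuum mixed differences with steps `(2π/L)e_l`, `(2π/L)e_{l'}` (`Φ` periodic). [cite: BenfattoGiulianiMastropietro2006, (2.36aa)] -/
theorem fwdDiff_iter₂_sample_eq (Φ : (Fin 2 → ℝ) → G) (hΦ : PlanePeriodic Φ) (l l' : Fin 2) (a b : ℕ) (q : TorusSite 2 L) :
    (_root_.fwdDiff (Pi.single l (1 : ZMod L) : TorusSite 2 L))^[a]
        ((_root_.fwdDiff (Pi.single l' (1 : ZMod L) : TorusSite 2 L))^[b] (fun q => Φ (latticeMomentum L q))) q =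
      ((_root_.fwdDiff ((2 * Real.pi / L) • (Pi.single l (1 : ℝ) : Fin 2 → ℝ)))^[a]
        ((_root_.fwdDiff ((2 * Real.pi / L) • (Pi.single l' (1 : ℝ) : Fin 2 → ℝ)))^[b] Φ)) (latticeMomentum L q) := by
  have hin : (_root_.fwdDiff (Pi.single l' (1 : ZMod L) : TorusSite 2 L))^[b] (fun q => Φ (latticeMomentum L q)) =
      fun q => ((_root_.fwdDiff ((2 * Real.pi / L) • (Pi.single l' (1 : ℝ) : Fin 2 → ℝ)))^[b] Φ) (latticeMomentum L q) := by
    funext q'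
    have h := fwdDiff_iter_sample_eq (L := L) l' 1 b Φ hΦ q'
    simpa only [one_smul, Nat.cast_one, one_mul] using h
  rw [hin]
  have h := fwdDiff_iter_sample_eq (L := L) l 1 a
    ((_root_.fwdDiff ((2 * Real.pi / L) • (Pi.single l' (1 : ℝ) : Fin 2 → ℝ)))^[b] Φ)
    (hΦ.fwdDiff_iter ((2 * Real.pi / L) • (Pi.single l' (1 : ℝ) : Fin 2 → ℝ)) b) q
  simpa only [one_smul, Nat.cast_one, one_mul] using h

/-- Differences commute with the Euclidean repackaging `toLp`. [cite: BenfattoGiulianiMastropietro2006, (2.36aa)] -/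
theorem fwdDiff_iter_comp_toLp (u : Fin 2 → ℝ) :
    ∀ (n : ℕ) (Φ : EuclideanSpace ℝ (Fin 2) → G),
      (_root_.fwdDiff u)^[n] (fun p => Φ (WithLp.toLp 2 p)) = fun p => ((_root_.fwdDiff (WithLp.toLp 2 u))^[n] Φ) (WithLp.toLp 2 p)
  | 0, Φ => rfl
  | n + 1, Φ => by
    have h1 : _root_.fwdDiff u (fun p => Φ (WithLp.toLp 2 p)) = fun p => (_root_.fwdDiff (WithLp.toLp 2 u) Φ) (WithLp.toLp 2 p) := by
      funext p; simp only [_root_.fwdDiff, WithLp.toLp_add]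
    rw [Function.iterate_succ_apply, Function.iterate_succ_apply, h1, fwdDiff_iter_comp_toLp u n]

omit [NeZero L] in
/-- The momentum step has Euclidean length `2π/L`. [cite: BenfattoGiulianiMastropietro2006, (2.36aa)] -/
theorem norm_toLp_step (l : Fin 2) : ‖WithLp.toLp 2 ((2 * Real.pi / L) • (Pi.single l (1 : ℝ) : Fin 2 → ℝ))‖ = 2 * Real.pi / L := by
  have h1 : ‖(WithLp.toLp 2 (Pi.single l (1 : ℝ) : Fin 2 → ℝ) : EuclideanSpace ℝ (Fin 2))‖ = 1 := by
    rw [show WithLp.toLp 2 (Pi.single l (1 : ℝ) : Fin 2 → ℝ) = EuclideanSpace.single l (1 : ℝ) from rfl]; simp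
  rw [WithLp.toLp_smul, norm_smul, h1, mul_one, Real.norm_of_nonneg (by positivity)]

/-- **Sampled mixed differences are bounded by the derivative sup**: `‖Δ_{e_l}^aΔ_{e_{l'}}^b(Φ∘p)(q)‖ ≤ K·(2π/L)^{a+b}` when `Φ` is
`C^{a+b}` on the Euclidean momentum plane with `‖D^{a+b}Φ‖ ≤ K` and periodic. [cite: BenfattoGiulianiMastropietro2006, (2.36aa)] -/
theorem norm_fwdDiff_iter₂_sample_le {F : Type*} [NormedAddCommGroup F] [NormedSpace ℝ F] (Φ : EuclideanSpace ℝ (Fin 2) → F)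
    (hper : PlanePeriodic (fun p : Fin 2 → ℝ => Φ (WithLp.toLp 2 p))) {a b : ℕ} (hΦ : ContDiff ℝ (↑(a + b : ℕ)) Φ) {K : ℝ}
    (hK : ∀ x, ‖iteratedFDeriv ℝ (a + b) Φ x‖ ≤ K) (l l' : Fin 2) (q : TorusSite 2 L) :
    ‖(_root_.fwdDiff (Pi.single l (1 : ZMod L) : TorusSite 2 L))^[a]
        ((_root_.fwdDiff (Pi.single l' (1 : ZMod L) : TorusSite 2 L))^[b]
          (fun q => Φ (WithLp.toLp 2 (latticeMomentum L q)))) q‖ ≤ K * (2 * Real.pi / L) ^ (a + b) := by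
  rw [fwdDiff_iter₂_sample_eq _ hper, fwdDiff_iter_comp_toLp _ b Φ, fwdDiff_iter_comp_toLp _ a]
  have h := norm_fwdDiff_iter_fwdDiff_iter_le (WithLp.toLp 2 ((2 * Real.pi / L) • (Pi.single l (1 : ℝ) : Fin 2 → ℝ)))
    (WithLp.toLp 2 ((2 * Real.pi / L) • (Pi.single l' (1 : ℝ) : Fin 2 → ℝ))) a b hΦ hK (WithLp.toLp 2 (latticeMomentum L q))
  rw [norm_toLp_step, norm_toLp_step, mul_assoc, ← pow_add] at h
  exact h

end Sampling

/-! ### §4 The sampled composition bounds -/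

section Composition

variable {L : ℕ} [NeZero L]

/-- **Sampled Faà di Bruno**: for `g` with a fibrewise envelope bound of order `k = a + b` and a periodic band `ũ` with `‖Dⁱũ‖ ≤ Dⁱ`
(`1 ≤ i ≤ k`), `‖Δ_{e_l}^aΔ_{e_{l'}}^b[y ↦ g(ω, ũ(p_y))](q)‖ ≤ (2π/L)^k·(C·E_σ(ω)·(k!·Dᵏ))`, `E_σ(ω) = 2/max(|ω| − σ, Λ/2)`.
[cite: BenfattoGiulianiMastropietro2006, (2.36aa) and §3 (3.2)] -/
theorem norm_fwdDiff_iter₂_comp_sample_le {Λ : ℝ} {g : FreqBand → ℂ} {a b : ℕ} (hg : ContDiff ℝ (↑(a + b : ℕ)) g)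
    {C σ : ℝ} (hG : FibreEnvBound Λ g (a + b) C σ) {u : EuclideanSpace ℝ (Fin 2) → ℝ} (hu : ContDiff ℝ (↑(a + b : ℕ)) u)
    (hper : ∀ (p : Fin 2 → ℝ) (z : Fin 2 → ℤ), u (WithLp.toLp 2 (fun i => p i + z i * (2 * Real.pi))) = u (WithLp.toLp 2 p))
    {D : ℝ} (hD : ∀ i, 1 ≤ i → i ≤ a + b → ∀ x, ‖iteratedFDeriv ℝ i u x‖ ≤ D ^ i) (ω : ℝ) (l l' : Fin 2) (q : TorusSite 2 L) :
    ‖(_root_.fwdDiff (Pi.single l (1 : ZMod L) : TorusSite 2 L))^[a]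
        ((_root_.fwdDiff (Pi.single l' (1 : ZMod L) : TorusSite 2 L))^[b]
          (fun y => g (fbPt ω (u (WithLp.toLp 2 (latticeMomentum L y)))))) q‖ ≤
      (2 * Real.pi / L) ^ (a + b) * (C * (2 / max (|ω| - σ) (Λ / 2)) * ((a + b) ! * D ^ (a + b))) := by
  have hK : ∀ x, ‖iteratedFDeriv ℝ (a + b) (fun p => g (fbPt ω (u p))) x‖ ≤ (a + b) ! * (C * (2 / max (|ω| - σ) (Λ / 2))) * D ^ (a + b) :=
    fun x => norm_iteratedFDeriv_comp_fbPt_le hg hu ω x (fun i hi => by simpa only [fbPt_apply_zero] using hG i hi (fbPt ω (u x)))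
      (fun i hi1 hi2 => hD i hi1 hi2 x)
  have hperΦ : PlanePeriodic (fun p : Fin 2 → ℝ => g (fbPt ω (u (WithLp.toLp 2 p)))) := fun p z => by simp only [hper]
  have h := norm_fwdDiff_iter₂_sample_le (L := L) (fun p => g (fbPt ω (u p))) hperΦ (hg.comp (contDiff_fbPt_comp hu ω)) hK l l' q
  calc _ ≤ (a + b) ! * (C * (2 / max (|ω| - σ) (Λ / 2))) * D ^ (a + b) * (2 * Real.pi / L) ^ (a + b) := h
    _ = (2 * Real.pi / L) ^ (a + b) * (C * (2 / max (|ω| - σ) (Λ / 2)) * ((a + b) ! * D ^ (a + b))) := by ring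

/-- **Sampled Leibniz–Faà di Bruno**: `‖Δ_{e_l}^aΔ_{e_{l'}}^b[y ↦ g(ω, ũ(p_y))·κ̃(p_y)](q)‖ ≤ (2π/L)^k·C·E_σ(ω)·Σ_{j≤k} C(k,j)·j!·Dʲ·W_{k-j}`
when moreover `‖Dⁱκ̃‖ ≤ Wᵢ` (`i ≤ k`), `κ̃` periodic. [cite: BenfattoGiulianiMastropietro2006, (2.36aa) and §3 (3.2)] -/
theorem norm_fwdDiff_iter₂_comp_mul_sample_le {Λ : ℝ} (hΛ : 0 < Λ) {g : FreqBand → ℂ} {a b : ℕ} (hg : ContDiff ℝ (↑(a + b : ℕ)) g)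
    {C σ : ℝ} (hG : FibreEnvBound Λ g (a + b) C σ) {u κ : EuclideanSpace ℝ (Fin 2) → ℝ} (hu : ContDiff ℝ (↑(a + b : ℕ)) u)
    (hκ : ContDiff ℝ (↑(a + b : ℕ)) κ)
    (hperu : ∀ (p : Fin 2 → ℝ) (z : Fin 2 → ℤ), u (WithLp.toLp 2 (fun i => p i + z i * (2 * Real.pi))) = u (WithLp.toLp 2 p))
    (hperκ : ∀ (p : Fin 2 → ℝ) (z : Fin 2 → ℤ), κ (WithLp.toLp 2 (fun i => p i + z i * (2 * Real.pi))) = κ (WithLp.toLp 2 p))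
    {D : ℝ} (hD : ∀ i, 1 ≤ i → i ≤ a + b → ∀ x, ‖iteratedFDeriv ℝ i u x‖ ≤ D ^ i)
    {W : ℕ → ℝ} (hW : ∀ i ≤ a + b, ∀ x, ‖iteratedFDeriv ℝ i κ x‖ ≤ W i) (ω : ℝ) (l l' : Fin 2) (q : TorusSite 2 L) :
    ‖(_root_.fwdDiff (Pi.single l (1 : ZMod L) : TorusSite 2 L))^[a]
        ((_root_.fwdDiff (Pi.single l' (1 : ZMod L) : TorusSite 2 L))^[b]
          (fun y => g (fbPt ω (u (WithLp.toLp 2 (latticeMomentum L y)))) * ((κ (WithLp.toLp 2 (latticeMomentum L y)) : ℝ) : ℂ))) q‖ ≤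
      (2 * Real.pi / L) ^ (a + b) * (C * (2 / max (|ω| - σ) (Λ / 2)) *
        ∑ j ∈ Finset.range (a + b + 1), ((a + b).choose j : ℝ) * j ! * D ^ j * W (a + b - j)) := by
  have hC0 : 0 ≤ C := hG.nonneg hΛ
  have hE : 0 ≤ 2 / max (|ω| - σ) (Λ / 2) := div_nonneg zero_le_two (le_max_of_le_right (by positivity))
  set C' : ℝ := C * (2 / max (|ω| - σ) (Λ / 2)) with hC'
  have hK : ∀ x, ‖iteratedFDeriv ℝ (a + b) (fun p => g (fbPt ω (u p)) * ((κ p : ℝ) : ℂ)) x‖ ≤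
      ∑ j ∈ Finset.range (a + b + 1), ((a + b).choose j : ℝ) * j ! * D ^ j * W (a + b - j) * C' := by
    intro x
    have h := norm_iteratedFDeriv_comp_fbPt_mul_le hg hu hκ ω x (C' := C')
      (fun i hi => by simpa only [fbPt_apply_zero] using hG i hi (fbPt ω (u x))) (fun i hi1 hi2 => hD i hi1 hi2 x)
    refine h.trans (Finset.sum_le_sum fun j hj => ?_)
    have hjk : j ≤ a + b := Nat.lt_succ_iff.1 (Finset.mem_range.1 hj)
    have hDj : 0 ≤ D ^ j := by
      rcases Nat.eq_zero_or_pos j with rfl | hj0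
      · simp
      · exact le_trans (norm_nonneg _) (hD j hj0 hjk x)
    calc ((a + b).choose j : ℝ) * (j ! * C' * D ^ j) * ‖iteratedFDeriv ℝ (a + b - j) κ x‖
        ≤ ((a + b).choose j : ℝ) * (j ! * C' * D ^ j) * W (a + b - j) :=
          mul_le_mul_of_nonneg_left (hW _ (Nat.sub_le _ _) x) (by positivity)
      _ = ((a + b).choose j : ℝ) * j ! * D ^ j * W (a + b - j) * C' := by ring
  have hperΦ : PlanePeriodic (fun p : Fin 2 → ℝ => g (fbPt ω (u (WithLp.toLp 2 p))) * ((κ (WithLp.toLp 2 p) : ℝ) : ℂ)) :=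
    fun p z => by simp only [hperu, hperκ]
  have hcd : ContDiff ℝ (↑(a + b : ℕ)) (fun p => g (fbPt ω (u p)) * ((κ p : ℝ) : ℂ)) :=
    (hg.comp (contDiff_fbPt_comp hu ω)).mul (Complex.ofRealCLM.contDiff.comp hκ)
  have h := norm_fwdDiff_iter₂_sample_le (L := L) (fun p => g (fbPt ω (u p)) * ((κ p : ℝ) : ℂ)) hperΦ hcd hK l l' q
  refine h.trans (le_of_eq ?_)
  rw [Finset.sum_mul, Finset.mul_sum, Finset.mul_sum]
  exact Finset.sum_congr rfl fun j _ => by ring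

/-- **Sampled band increment**: for lattice bands `v = ṽ∘p`, `w = w̃∘p` with `‖Dⁱ(ṽ + s·w̃)‖ ≤ Dⁱ` (`1 ≤ i ≤ k`, all `s ∈ [0,1]`) and
`‖Dⁱw̃‖ ≤ Wᵢ` (`i ≤ k`), and `g ∈ C^{k+1}` whose band derivative `∂_{e₁}g` has a fibrewise envelope bound of order `k` with constant `C`,
`‖Δ_{e_l}^aΔ_{e_{l'}}^b[g(ω, v + w)](q) − Δ_{e_l}^aΔ_{e_{l'}}^b[g(ω, v)](q)‖ ≤ (2π/L)^k·C·E_σ(ω)·Σ_{j≤k} C(k,j)·j!·Dʲ·W_{k-j}`.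
[cite: BenfattoGiulianiMastropietro2006, §3 (3.2)–(3.8)] -/
theorem norm_fwdDiff_iter₂_increment_sample_le {Λ : ℝ} (hΛ : 0 < Λ) {g : FreqBand → ℂ} {a b : ℕ}
    (hg : ContDiff ℝ (((a + b : ℕ) : ℕ∞) + 1) g) {C σ : ℝ} (hG : FibreEnvBound Λ (fbDir g fbE1) (a + b) C σ)
    {v w : EuclideanSpace ℝ (Fin 2) → ℝ} (hv : ContDiff ℝ (↑(a + b : ℕ)) v) (hw : ContDiff ℝ (↑(a + b : ℕ)) w)
    (hperv : ∀ (p : Fin 2 → ℝ) (z : Fin 2 → ℤ), v (WithLp.toLp 2 (fun i => p i + z i * (2 * Real.pi))) = v (WithLp.toLp 2 p))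
    (hperw : ∀ (p : Fin 2 → ℝ) (z : Fin 2 → ℤ), w (WithLp.toLp 2 (fun i => p i + z i * (2 * Real.pi))) = w (WithLp.toLp 2 p))
    {D : ℝ} (hD : ∀ s ∈ Icc (0 : ℝ) 1, ∀ i, 1 ≤ i → i ≤ a + b → ∀ x, ‖iteratedFDeriv ℝ i (fun x => v x + s * w x) x‖ ≤ D ^ i)
    {W : ℕ → ℝ} (hW : ∀ i ≤ a + b, ∀ x, ‖iteratedFDeriv ℝ i w x‖ ≤ W i) (ω : ℝ) (l l' : Fin 2) (q : TorusSite 2 L) :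
    ‖(_root_.fwdDiff (Pi.single l (1 : ZMod L) : TorusSite 2 L))^[a]
          ((_root_.fwdDiff (Pi.single l' (1 : ZMod L) : TorusSite 2 L))^[b]
            (fun y => g (fbPt ω (v (WithLp.toLp 2 (latticeMomentum L y)) + w (WithLp.toLp 2 (latticeMomentum L y)))))) q -
        (_root_.fwdDiff (Pi.single l (1 : ZMod L) : TorusSite 2 L))^[a]
          ((_root_.fwdDiff (Pi.single l' (1 : ZMod L) : TorusSite 2 L))^[b]
            (fun y => g (fbPt ω (v (WithLp.toLp 2 (latticeMomentum L y)))))) q‖ ≤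
      (2 * Real.pi / L) ^ (a + b) * (C * (2 / max (|ω| - σ) (Λ / 2)) *
        ∑ j ∈ Finset.range (a + b + 1), ((a + b).choose j : ℝ) * j ! * D ^ j * W (a + b - j)) := by
  have hdg : Differentiable ℝ g := hg.differentiable (by exact_mod_cast Nat.succ_ne_zero (a + b))
  have hg1 : ContDiff ℝ (↑(a + b : ℕ)) (fbDir g fbE1) := contDiff_fbDir hg fbE1
  refine norm_fwdDiff_iter₂_comp_fbPt_band_increment_le hdg ω (fun y => v (WithLp.toLp 2 (latticeMomentum L y)))
    (fun y => w (WithLp.toLp 2 (latticeMomentum L y))) _ _ a b q (fun s hs => ?_)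
  have h := norm_fwdDiff_iter₂_comp_mul_sample_le (L := L) hΛ hg1 hG (u := fun x => v x + s * w x) (κ := w)
    (hv.add (contDiff_const.mul hw)) hw (fun p z => by simp only [hperv, hperw]) hperw (hD s (Ico_subset_Icc_self hs)) hW ω l l' q
  exact h

end Composition

end Literature.MathematicalPhysics.QuantumLattice

end
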